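import Literature.AlgebraicGeometry.Motives.HodgeStructureCorrespondenceDegrees
import HarnessLib

/-!
# The Gysin map `φ_*` of a morphism (`η_B(φ_* x ∪ y) = η_A(x ∪ φ^* y)`), Milne's Prop. 5.4 (`φ_*` commutes with `L(A × B)`),
# Cor. 5.5 (`φ_*` preserves Lefschetz classes) and Cor. 5.6 (the graph `Γ_φ = [φ_*]` is Lefschetz)

[topic AlgebraicGeometry/Motives]

Layer `Literature/AlgebraicGeometry/Motives`, lane `lit-hodgefound` (Track 2 foundations library; prover seat `lit-hodgefound-p34`,
generation 32, row g32-#6). ONE definition (`IsSymplectic.pushforward`, with a body) and theorems; no named fact, no instance, no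
notation; net debt `0`. Sequel of rows g32-#1–#5 (Künneth `Φ`, Gysin of a projection `gysinSnd`, the dictionary `u ↦ ū = corrMap`,
classes `[T] = corrEquiv⁻¹ T`, Prop. 5.7 / Cor. 5.8 / Thm. 5.9, degrees).

On the carrier `H•(A) = ⋀_ℚ V` (`V = H¹(A, ℚ)` a polarized Hodge structure of odd weight, `dim V = 2g`, orientation `τ_E`), a
homomorphism `φ : A → B` acts on `H¹` by a morphism of Hodge structures `f = φ^*|H¹ : H¹(B) → H¹(A)` (the tree's `Hom H_B H_A`), on
`H•` by `φ^* = ⋀f` (`ExteriorAlgebra.map f`), and covariantly by the GYSIN MAP `φ_* : H•(A) → H•(B)`, the adjoint of `φ^*` for the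
Poincaré pairings — Milne's "projection formula `η_B(φ_*(x) ∪ y) = η_A(x ∪ φ^*(y))`" (p. 663), which on the carrier DEFINES `φ_*`
(`τ_B` is a perfect pairing, row g32-#1 `IsSymplectic.nondegenerate_trace_mul`).

## Sources, VERBATIM

J. S. Milne, *Lefschetz classes on abelian varieties*, Duke Math. J. **96** (1999) [Milne1999LefschetzClasses], §5 p. 663:
"**Proposition 5.4.** For any regular map `φ : A → B` of abelian varieties, the map `φ_* : H^{2s}(A)(s) → H^{2s+2c}(B)(s + c)` commutes
with the actions of `L(A × B)`. *Proof.* Let `g = dim A`. Because `H^{2g}(A)(g)` consists of Lefschetz classes […] the action of `L(A)`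
on it is trivial. A similar remark applies to `B`. Let `α ∈ L(A × B)`. On replacing `x` and `y` with `αx` and `αy` in the projection
formula `η_B(φ_*(x) ∪ y) = η_A(x ∪ φ^*(y))`, `x ∈ H^{2g−2s}(A)(g − s)`, `y ∈ H^{2s}(B)(s)`, and using that the action of `α` commutes with
cup-products (by definition) and the action of `φ^*`, we find that `η_B(φ_*(αx) ∪ αy) = η_A(αx ∪ φ^*(αy)) = η_A(x ∪ φ^*(y)) = η_B(φ_*(x) ∪ y)`.
Therefore `η_B(α⁻¹φ_*(αx) ∪ y) = η_B(φ_*(x) ∪ y)`. Since this holds for all `y` […] `α⁻¹φ_*(αx) = φ_*(x)`."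
"**Corollary 5.5.** For any regular map `φ : A → B` of abelian varieties, `φ_*` maps Lefschetz classes on `A` to Lefschetz classes on
`B`. *Proof.* Because `φ_*` commutes with the actions of `L(A × B)`, it maps classes fixed by `L(A)` to classes fixed by `L(B)`, and we
can apply Corollary 4.5."
"**Corollary 5.6.** The graph of any regular map `α : A → B` of abelian varieties is Lefschetz."
p. 663 (before 5.4): "`φ^* : H^*(A′) → H^*(A)` equals `V(φ)^∨`, it also is `L`-equivariant."  p. 664: the dictionary `u ↦ ū`,
`ū(x) = q_*(p^* x ∪ u)`, and Prop. 5.7 ("`u` is Lefschetz iff `ū` commutes with the actions of `L(A × B)`").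

## What is DEFINED / PROVED

* §1 **`IsSymplectic.pushforward`** (`φ_*`, the Gysin map of `φ^* = T : ⋀W₂ → ⋀W₁` for orientations `τ₁`, `τ₂`), characterised by the
  projection formula **`IsSymplectic.trace_pushforward_mul`: `τ₂(φ_* x ∧ y) = τ₁(x ∧ φ^* y)`** and uniqueness
  `IsSymplectic.eq_pushforward_of_forall_trace_mul_eq`; `pushforward_id`, functoriality `pushforward_comp` (`(ψφ)_* = ψ_* φ_*`), and
  **`pushforward_map_inr`: `q_* = gysinSnd`** (the Gysin map of the projection `q : A × B → B` of row g32-#1 IS `(q^*)_*`).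
* §2 degrees: `trace_proj_mul_eq`; **`IsSymplectic.pushforward_apply_mem`** (`φ_* ⋀ⁱW₁ ⊆ ⋀^{i+2g₂−2g₁}W₂` for degree-preserving `φ^*` —
  "`φ_* : H^{2s}(A) → H^{2s+2c}(B)`, `c = dim B − dim A`"), `…_apply_eq_zero`, and **`IsSymplectic.corrEquiv_symm_pushforward_mem_exteriorPower`:
  the graph class `[φ_*] ∈ ⋀^{2g₂}(W₁ × W₂)`** (`Γ_φ ∈ H^{2 dim B}(A × B)`).
* §3 **PROP. 5.4 in linear algebra: `IsSymplectic.pushforward_map_apply` / `map_comp_pushforward`** — if `φ^*` intertwines `⋀γ₂` and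
  `⋀γ₁` for `τ`-preserving `γᵢ` (`⋀γᵢ ωᵢ = ωᵢ`), then so does `φ_*` (Milne's proof verbatim: replace `x, y` by `γx, γy` in the projection
  formula); `IsSymplectic.pushforward_toComplexAlg_apply` (`(φ_*)_ℂ Θ = Θ φ_*`).
* §4 on the carrier (`Hᵢ` polarized of the same odd weight, `dim Vᵢ = 2gᵢ`, `f : Hom H₂ H₁`): **PROP. 5.4 AS PRINTED
  `Polarization.map_comp_pushforward_of_blockDiag_mem`** (`⋀γ₂ ∘ φ_{*,ℂ} = φ_{*,ℂ} ∘ ⋀γ₁` for every `γ₁ ⊕ γ₂ ∈ S(H₁ ⊕ H₂)(ℂ)`);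
  **COR. 5.6 AS PRINTED `Polarization.corrEquiv_symm_pushforward_mem_adjoin_hodgeClasses_two`** (`Γ_φ = [φ_*] ∈ ℚ[B¹(H₁ ⊕ H₂)]`) and
  `…_mem_map_divisorClasses` (`Γ_φ ∈ D^{g₂}(H₁ ⊕ H₂)`); the transpose **`Polarization.corrEquiv_symm_map_mem_adjoin_hodgeClasses_two`**
  (`ᵗΓ_φ = [φ^*] ∈ ℚ[B¹(H₂ ⊕ H₁)]`, in `D^{g₂}(H₂ ⊕ H₁)`); **COR. 5.5 AS PRINTED `Polarization.pushforward_apply_mem_adjoin_hodgeClasses_two`**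
  (with the lifting hypothesis "`L(B)` is a quotient of `L(A × B)`" on `ℂ`-points, as in row g32-#3) and unconditionally for `A = B`
  (`…_of_prod_self`).

TWIN NOTICE (RULING 29 bis): torus-forms twins (p08's `ComplexTorusCorrespondenceRing…`, pull-backs of forms) are neither imported nor
restated.

## References

* [Milne1999LefschetzClasses] J. S. Milne, *Lefschetz classes on abelian varieties*, Duke Math. J. 96 (1999), §5 pp. 663–664 (Prop. 5.4,
  Cor. 5.5, Cor. 5.6, the dictionary `u ↦ ū`, Prop. 5.7).
* [BourbakiAlgebraI1989] N. Bourbaki, *Algebra I, Chapters 1–3* (1989), Ch. III §7 no. 2 (functoriality of `⋀`), no. 5 Prop. 8.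
-/

noncomputable section

open scoped TensorProduct

namespace Literature.AlgebraicGeometry.Motives

universe u

namespace ExteriorLefschetz

open Literature.Algebra.Lie ExteriorAlgebra

variable {K : Type*} [Field K] [CharZero K] {W₁ W₂ W₃ : Type*} [AddCommGroup W₁] [Module K W₁] [AddCommGroup W₂] [Module K W₂]
  [AddCommGroup W₃] [Module K W₃]

/-! ## §1 The Gysin map `φ_*`: `τ₂(φ_* x ∧ y) = τ₁(x ∧ φ^* y)` -/

/-- **The Gysin map (pushforward) `φ_* : ⋀W₁ → ⋀W₂` of `φ^* = T : ⋀W₂ → ⋀W₁`**, for orientations `τ₁ = τ_{ω₁}` and `τ₂ = τ_{ω₂}`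
(`ω₂` symplectic): the adjoint of `T` for the Poincaré pairings, `φ_* x = θ₂⁻¹(y ↦ τ₁(x ∧ T y))` with `θ₂ : ⋀W₂ ⥲ (⋀W₂)^∨`,
`θ₂(z) = τ₂(z ∧ ·)` (row g32-#1 `IsSymplectic.nondegenerate_trace_mul`). It is THE map with "`η_B(φ_*(x) ∪ y) = η_A(x ∪ φ^*(y))`"
(`trace_pushforward_mul`, `eq_pushforward_of_forall_trace_mul_eq`). [cite: Milne1999LefschetzClasses, §5 proof of Prop. 5.4 (p. 663, "the projection formula")] -/
def IsSymplectic.pushforward (ω₁ : ExteriorAlgebra K W₁) (g₁ : ℕ) {ω₂ : ExteriorAlgebra K W₂} {g₂ : ℕ} (hω₂ : IsSymplectic ω₂ g₂)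
    (T : ExteriorAlgebra K W₂ →ₗ[K] ExteriorAlgebra K W₁) : ExteriorAlgebra K W₁ →ₗ[K] ExteriorAlgebra K W₂ :=
  haveI := hω₂.finiteDimensional_exteriorAlgebra
  (LinearMap.BilinForm.toDual ((LinearMap.mul K (ExteriorAlgebra K W₂)).compr₂ (trace ω₂ g₂)) hω₂.nondegenerate_trace_mul).symm.toLinearMap ∘ₗ
    ((LinearMap.mul K (ExteriorAlgebra K W₁)).compr₂ (trace ω₁ g₁)).compl₂ T

variable {ω₁ : ExteriorAlgebra K W₁} {g₁ : ℕ} {ω₂ : ExteriorAlgebra K W₂} {g₂ : ℕ} {ω₃ : ExteriorAlgebra K W₃} {g₃ : ℕ}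

/-- **The projection formula `τ₂(φ_* x ∧ y) = τ₁(x ∧ φ^* y)`.** [cite: Milne1999LefschetzClasses, §5 proof of Prop. 5.4 (p. 663)] -/
theorem IsSymplectic.trace_pushforward_mul (hω₂ : IsSymplectic ω₂ g₂) (T : ExteriorAlgebra K W₂ →ₗ[K] ExteriorAlgebra K W₁)
    (x : ExteriorAlgebra K W₁) (y : ExteriorAlgebra K W₂) :
    trace ω₂ g₂ (hω₂.pushforward ω₁ g₁ T x * y) = trace ω₁ g₁ (x * T y) := by
  haveI := hω₂.finiteDimensional_exteriorAlgebra
  show ((LinearMap.mul K (ExteriorAlgebra K W₂)).compr₂ (trace ω₂ g₂))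
      ((LinearMap.BilinForm.toDual ((LinearMap.mul K (ExteriorAlgebra K W₂)).compr₂ (trace ω₂ g₂)) hω₂.nondegenerate_trace_mul).symm
        (((LinearMap.mul K (ExteriorAlgebra K W₁)).compr₂ (trace ω₁ g₁)).compl₂ T x)) y =
    ((LinearMap.mul K (ExteriorAlgebra K W₁)).compr₂ (trace ω₁ g₁)).compl₂ T x y
  exact LinearMap.BilinForm.apply_toDual_symm_apply _ _

/-- **Uniqueness: `φ_*` is the only map satisfying the projection formula** ("Since this holds for all `y` […]").
[cite: Milne1999LefschetzClasses, §5 proof of Prop. 5.4 (p. 663)] -/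
theorem IsSymplectic.eq_pushforward_of_forall_trace_mul_eq (hω₂ : IsSymplectic ω₂ g₂) {T : ExteriorAlgebra K W₂ →ₗ[K] ExteriorAlgebra K W₁}
    {S : ExteriorAlgebra K W₁ →ₗ[K] ExteriorAlgebra K W₂} (h : ∀ x y, trace ω₂ g₂ (S x * y) = trace ω₁ g₁ (x * T y)) :
    S = hω₂.pushforward ω₁ g₁ T := by
  refine LinearMap.ext fun x ↦ sub_eq_zero.mp (hω₂.eq_zero_of_forall_trace_mul_eq_zero fun y ↦ ?_)
  rw [sub_mul, map_sub, h, hω₂.trace_pushforward_mul, sub_self]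

/-- `(id)_* = id`. [cite: Milne1999LefschetzClasses, §5 p. 663] -/
theorem IsSymplectic.pushforward_id {W : Type*} [AddCommGroup W] [Module K W] {ω : ExteriorAlgebra K W} {g : ℕ} (hω : IsSymplectic ω g) :
    hω.pushforward ω g LinearMap.id = LinearMap.id := by
  refine Eq.symm (hω.eq_pushforward_of_forall_trace_mul_eq fun x y ↦ ?_)
  rw [LinearMap.id_apply, LinearMap.id_apply]

/-- **Functoriality `(ψ φ)_* = ψ_* φ_*`** (`φ : A₁ → A₂`, `ψ : A₂ → A₃`; `(ψφ)^* = φ^* ψ^*`). [cite: Milne1999LefschetzClasses, §5 p. 663] -/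
theorem IsSymplectic.pushforward_comp (hω₂ : IsSymplectic ω₂ g₂) (hω₃ : IsSymplectic ω₃ g₃)
    (T₁₂ : ExteriorAlgebra K W₂ →ₗ[K] ExteriorAlgebra K W₁) (T₂₃ : ExteriorAlgebra K W₃ →ₗ[K] ExteriorAlgebra K W₂) :
    hω₃.pushforward ω₁ g₁ (T₁₂ ∘ₗ T₂₃) = hω₃.pushforward ω₂ g₂ T₂₃ ∘ₗ hω₂.pushforward ω₁ g₁ T₁₂ := by
  refine Eq.symm (hω₃.eq_pushforward_of_forall_trace_mul_eq fun x z ↦ ?_)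
  rw [LinearMap.comp_apply, hω₃.trace_pushforward_mul, hω₂.trace_pushforward_mul, LinearMap.comp_apply]

/-- **`q_* = gysinSnd`**: for the projection `q : A × B → B` (`q^* = ⋀(inr)`, orientation `τ_{ω₁ ⊞ ω₂}` on `⋀(W₁ × W₂)`), the Gysin map
`(q^*)_*` is the Gysin map `gysinSnd ω₁ g₁` of row g32-#1 (its projection formula `IsSymplectic.trace_mul_map_inr_eq`).
[cite: Milne1999LefschetzClasses, §5 p. 664 ("—q_*→")] -/
theorem IsSymplectic.pushforward_map_inr (hω₁ : IsSymplectic ω₁ g₁) (hω₂ : IsSymplectic ω₂ g₂) :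
    hω₂.pushforward (ExteriorAlgebra.map (LinearMap.inl K W₁ W₂) ω₁ + ExteriorAlgebra.map (LinearMap.inr K W₁ W₂) ω₂) (g₁ + g₂)
        (ExteriorAlgebra.map (LinearMap.inr K W₁ W₂)).toLinearMap = gysinSnd ω₁ g₁ := by
  refine Eq.symm (hω₂.eq_pushforward_of_forall_trace_mul_eq fun u y ↦ ?_)
  exact (hω₁.trace_mul_map_inr_eq hω₂ u y).symm

/-! ## §2 Degrees: `φ_* : ⋀ⁱW₁ → ⋀^{i + 2g₂ − 2g₁}W₂`; `[φ_*] ∈ ⋀^{2g₂}(W₁ × W₂)` -/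

/-- `τ(π_m z ∧ y) = τ(z ∧ y)` for `y ∈ ⋀ᶜW`, `m + c = 2g` (the other components of `z` pair to zero with `y`). [cite: Milne1999LefschetzClasses, §5 p. 662 (graded pieces)] -/
theorem trace_proj_mul_eq {W : Type*} [AddCommGroup W] [Module K W] {ω : ExteriorAlgebra K W} {g m c : ℕ} (hmc : m + c = 2 * g)
    (z : ExteriorAlgebra K W) {y : ExteriorAlgebra K W} (hy : y ∈ ⋀[K]^c W) :
    trace ω g (GradedAlgebra.proj (fun i : ℕ ↦ ⋀[K]^i W) m z * y) = trace ω g (z * y) := by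
  induction z using DirectSum.Decomposition.inductionOn (fun i : ℕ ↦ ⋀[K]^i W) with
  | zero => rw [map_zero]
  | add z z' hz hz' => rw [map_add, add_mul, map_add, hz, hz', add_mul, map_add]
  | @homogeneous m' z =>
    rw [GradedAlgebra.proj_apply]
    by_cases hm : m' = m
    · subst hm
      rw [DirectSum.decompose_of_mem_same (fun i : ℕ ↦ ⋀[K]^i W) z.2]
    · rw [DirectSum.decompose_of_mem_ne (fun i : ℕ ↦ ⋀[K]^i W) z.2 hm, zero_mul, map_zero,
        trace_mul_eq_zero_of_add_ne z.2 hy (by omega)]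

/-- **"`φ_* : H^{2s}(A)(s) → H^{2s+2c}(B)(s + c)`": for degree-preserving `φ^*` (`φ^* ⋀ʲW₂ ⊆ ⋀ʲW₁`) and `x ∈ ⋀ⁱW₁`, `φ_* x ∈ ⋀ʲW₂` with
`i + 2g₂ = 2g₁ + j`** (`φ_* x` pairs non-trivially only with `⋀^{2g₁−i}W₂`). [cite: Milne1999LefschetzClasses, §5 Prop. 5.4 (p. 663)] -/
theorem IsSymplectic.pushforward_apply_mem (hω₂ : IsSymplectic ω₂ g₂) {T : ExteriorAlgebra K W₂ →ₗ[K] ExteriorAlgebra K W₁}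
    (hT : ∀ j : ℕ, ∀ y ∈ ⋀[K]^j W₂, T y ∈ ⋀[K]^j W₁) {i j : ℕ} (hij : i + 2 * g₂ = 2 * g₁ + j) {x : ExteriorAlgebra K W₁}
    (hx : x ∈ ⋀[K]^i W₁) : hω₂.pushforward ω₁ g₁ T x ∈ ⋀[K]^j W₂ := by
  set z := hω₂.pushforward ω₁ g₁ T x with hz
  suffices h : z - GradedAlgebra.proj (fun m : ℕ ↦ ⋀[K]^m W₂) j z = 0 by
    rw [sub_eq_zero] at h
    rw [h, GradedAlgebra.proj_apply]
    exact (DirectSum.decompose (fun m : ℕ ↦ ⋀[K]^m W₂) z j).2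
  refine hω₂.eq_zero_of_forall_trace_mul_eq_zero fun y ↦ ?_
  induction y using DirectSum.Decomposition.inductionOn (fun m : ℕ ↦ ⋀[K]^m W₂) with
  | zero => rw [mul_zero, map_zero]
  | add y y' hy hy' => rw [mul_add, map_add, hy, hy', add_zero]
  | @homogeneous c y =>
    rw [sub_mul, map_sub, sub_eq_zero]
    by_cases hc : j + c = 2 * g₂
    · exact (trace_proj_mul_eq hc z y.2).symm
    · have hpj : GradedAlgebra.proj (fun m : ℕ ↦ ⋀[K]^m W₂) j z ∈ ⋀[K]^j W₂ := by
        rw [GradedAlgebra.proj_apply]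
        exact (DirectSum.decompose (fun m : ℕ ↦ ⋀[K]^m W₂) z j).2
      rw [trace_mul_eq_zero_of_add_ne hpj y.2 hc, hz, hω₂.trace_pushforward_mul,
        trace_mul_eq_zero_of_add_ne hx (hT c y y.2) (by omega)]

/-- `φ_* x = 0` for `x ∈ ⋀ⁱW₁` with `i + 2g₂ < 2g₁` (no target degree). [cite: Milne1999LefschetzClasses, §5 Prop. 5.4 (p. 663)] -/
theorem IsSymplectic.pushforward_apply_eq_zero (hω₂ : IsSymplectic ω₂ g₂) {T : ExteriorAlgebra K W₂ →ₗ[K] ExteriorAlgebra K W₁}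
    (hT : ∀ j : ℕ, ∀ y ∈ ⋀[K]^j W₂, T y ∈ ⋀[K]^j W₁) {i : ℕ} (hi : i + 2 * g₂ < 2 * g₁) {x : ExteriorAlgebra K W₁}
    (hx : x ∈ ⋀[K]^i W₁) : hω₂.pushforward ω₁ g₁ T x = 0 := by
  refine hω₂.eq_zero_of_forall_trace_mul_eq_zero fun y ↦ ?_
  induction y using DirectSum.Decomposition.inductionOn (fun m : ℕ ↦ ⋀[K]^m W₂) with
  | zero => rw [mul_zero, map_zero]
  | add y y' hy hy' => rw [mul_add, map_add, hy, hy', add_zero]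
  | @homogeneous c y =>
    rw [hω₂.trace_pushforward_mul]
    by_cases hc : i + c = 2 * g₁
    · have h0 : (y : ExteriorAlgebra K W₂) = 0 :=
        (Submodule.eq_bot_iff _).mp (hω₂.exteriorPower_eq_bot_of_lt c (by omega)) _ y.2
      rw [h0, map_zero, mul_zero, map_zero]
    · exact trace_mul_eq_zero_of_add_ne hx (hT c y y.2) hc

/-- **The graph class `Γ_φ = [φ_*]` lies in `⋀^{2g₂}(W₁ × W₂)`** (`Γ_φ ∈ H^{2 dim B}(A × B)`; row g32-#5 `corrEquiv_symm_mem_exteriorPower`).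
[cite: Milne1999LefschetzClasses, §5 Cor. 5.6 (p. 663) and p. 664] -/
theorem IsSymplectic.corrEquiv_symm_pushforward_mem_exteriorPower (hω₁ : IsSymplectic ω₁ g₁) (hω₂ : IsSymplectic ω₂ g₂)
    {T : ExteriorAlgebra K W₂ →ₗ[K] ExteriorAlgebra K W₁} (hT : ∀ j : ℕ, ∀ y ∈ ⋀[K]^j W₂, T y ∈ ⋀[K]^j W₁) :
    hω₁.corrEquiv.symm (hω₂.pushforward ω₁ g₁ T) ∈ ⋀[K]^(2 * g₂) (W₁ × W₂) :=
  hω₁.corrEquiv_symm_mem_exteriorPower (fun _ _ hij _ hx ↦ hω₂.pushforward_apply_mem hT hij hx)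
    fun _ hi _ hx ↦ hω₂.pushforward_apply_eq_zero hT hi hx

/-- **The transpose graph `ᵗΓ_φ = [φ^*]` lies in `⋀^{2g₂}(W₂ × W₁)`** for degree-preserving `φ^*` (e.g. `φ^* = ⋀f`).
[cite: Milne1999LefschetzClasses, §5 p. 664] -/
theorem IsSymplectic.corrEquiv_symm_mem_exteriorPower_of_forall_apply_mem (hω₂ : IsSymplectic ω₂ g₂)
    {T : ExteriorAlgebra K W₂ →ₗ[K] ExteriorAlgebra K W₁} (hT : ∀ j : ℕ, ∀ y ∈ ⋀[K]^j W₂, T y ∈ ⋀[K]^j W₁) :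
    hω₂.corrEquiv.symm T ∈ ⋀[K]^(2 * g₂) (W₂ × W₁) := by
  simpa using hω₂.corrEquiv_symm_mem_exteriorPower_of_forall_apply_mem_add (d := 0) (T := T) fun j y hy ↦ by
    simpa using hT j y hy

/-! ## §3 Prop. 5.4 in linear algebra: `φ_*` inherits the equivariance of `φ^*` -/

/-- **PROP. 5.4 (linear algebra): if `φ^*(⋀γ₂ y) = ⋀γ₁(φ^* y)` for automorphisms `γᵢ` with `⋀γᵢ ωᵢ = ωᵢ`, then `φ_*(⋀γ₁ x) = ⋀γ₂(φ_* x)`.**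
Milne's proof verbatim: `τ₂(φ_*(γx) ∧ γy) = τ₁(γx ∧ φ^*(γy)) = τ₁(γ(x ∧ φ^* y)) = τ₁(x ∧ φ^* y) = τ₂(φ_* x ∧ y) = τ₂(γ(φ_* x) ∧ γy)` (`τᵢ ∘ ⋀γᵢ = τᵢ`,
the tree's `IsSymplectic.trace_map`), for all `y`. [cite: Milne1999LefschetzClasses, §5 Prop. 5.4 (p. 663)] -/
theorem IsSymplectic.pushforward_map_apply (hω₁ : IsSymplectic ω₁ g₁) (hω₂ : IsSymplectic ω₂ g₂) {γ₁ : W₁ ≃ₗ[K] W₁} {γ₂ : W₂ ≃ₗ[K] W₂}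
    (hγ₁ : ExteriorAlgebra.map (γ₁ : W₁ →ₗ[K] W₁) ω₁ = ω₁) (hγ₂ : ExteriorAlgebra.map (γ₂ : W₂ →ₗ[K] W₂) ω₂ = ω₂)
    {T : ExteriorAlgebra K W₂ →ₗ[K] ExteriorAlgebra K W₁}
    (hT : ∀ y, T (ExteriorAlgebra.map (γ₂ : W₂ →ₗ[K] W₂) y) = ExteriorAlgebra.map (γ₁ : W₁ →ₗ[K] W₁) (T y))
    (x : ExteriorAlgebra K W₁) :
    hω₂.pushforward ω₁ g₁ T (ExteriorAlgebra.map (γ₁ : W₁ →ₗ[K] W₁) x) =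
      ExteriorAlgebra.map (γ₂ : W₂ →ₗ[K] W₂) (hω₂.pushforward ω₁ g₁ T x) := by
  refine sub_eq_zero.mp (hω₂.eq_zero_of_forall_trace_mul_eq_zero fun y ↦ ?_)
  obtain ⟨y, rfl⟩ := map_equiv_surjective γ₂ y
  rw [sub_mul, map_sub, sub_eq_zero, hω₂.trace_pushforward_mul, hT, ← map_mul, hω₁.trace_map _ hγ₁, ← map_mul,
    hω₂.trace_map _ hγ₂, hω₂.trace_pushforward_mul]

/-- **PROP. 5.4 (linear algebra), composition form: `φ^* ∘ ⋀γ₂ = ⋀γ₁ ∘ φ^* ⟹ ⋀γ₂ ∘ φ_* = φ_* ∘ ⋀γ₁`.** [cite: Milne1999LefschetzClasses, §5 Prop. 5.4 (p. 663)] -/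
theorem IsSymplectic.map_comp_pushforward (hω₁ : IsSymplectic ω₁ g₁) (hω₂ : IsSymplectic ω₂ g₂) {γ₁ : W₁ ≃ₗ[K] W₁} {γ₂ : W₂ ≃ₗ[K] W₂}
    (hγ₁ : ExteriorAlgebra.map (γ₁ : W₁ →ₗ[K] W₁) ω₁ = ω₁) (hγ₂ : ExteriorAlgebra.map (γ₂ : W₂ →ₗ[K] W₂) ω₂ = ω₂)
    {T : ExteriorAlgebra K W₂ →ₗ[K] ExteriorAlgebra K W₁}
    (hT : T ∘ₗ (ExteriorAlgebra.map (γ₂ : W₂ →ₗ[K] W₂)).toLinearMap = (ExteriorAlgebra.map (γ₁ : W₁ →ₗ[K] W₁)).toLinearMap ∘ₗ T) :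
    (ExteriorAlgebra.map (γ₂ : W₂ →ₗ[K] W₂)).toLinearMap ∘ₗ hω₂.pushforward ω₁ g₁ T =
      hω₂.pushforward ω₁ g₁ T ∘ₗ (ExteriorAlgebra.map (γ₁ : W₁ →ₗ[K] W₁)).toLinearMap :=
  LinearMap.ext fun x ↦ (hω₁.pushforward_map_apply hω₂ hγ₁ hγ₂ (fun y ↦ LinearMap.congr_fun hT y) x).symm

section BaseChange

variable {V₁ V₂ : Type u} [AddCommGroup V₁] [Module ℚ V₁] [AddCommGroup V₂] [Module ℚ V₂]

/-- **`(φ_*)_ℂ Θ = Θ φ_*`**: the Gysin map of a complexification `T_ℂ` (`T_ℂ Θ = Θ T`, orientations `τ_{Θωᵢ}`) extends the Gysin map of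
`T` — both satisfy the projection formula against `Θ(⋀_ℚ V₂)`, which spans. [cite: Milne1999LefschetzClasses, §5 Prop. 5.4 (p. 663)]
[cite: BourbakiAlgebraI1989, Ch. III §7 no. 5 Prop. 8] -/
theorem IsSymplectic.pushforward_toComplexAlg_apply {ω₁ : ExteriorAlgebra ℚ V₁} {g₁ : ℕ} {ω₂ : ExteriorAlgebra ℚ V₂} {g₂ : ℕ}
    (hω₁ : IsSymplectic ω₁ g₁) (hω₁' : IsSymplectic (toComplexAlg V₁ ω₁) g₁) (hω₂ : IsSymplectic ω₂ g₂)
    (hω₂' : IsSymplectic (toComplexAlg V₂ ω₂) g₂) {T : ExteriorAlgebra ℚ V₂ →ₗ[ℚ] ExteriorAlgebra ℚ V₁}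
    {T' : ExteriorAlgebra ℂ (ℂ ⊗[ℚ] V₂) →ₗ[ℂ] ExteriorAlgebra ℂ (ℂ ⊗[ℚ] V₁)} (hT : ∀ y, T' (toComplexAlg V₂ y) = toComplexAlg V₁ (T y))
    (x : ExteriorAlgebra ℚ V₁) :
    hω₂'.pushforward (toComplexAlg V₁ ω₁) g₁ T' (toComplexAlg V₁ x) = toComplexAlg V₂ (hω₂.pushforward ω₁ g₁ T x) := by
  refine sub_eq_zero.mp (hω₂'.eq_zero_of_forall_trace_mul_eq_zero fun Y ↦ ?_)
  rw [sub_mul, map_sub, sub_eq_zero]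
  have key : trace (toComplexAlg V₂ ω₂) g₂ ∘ₗ LinearMap.mul ℂ (ExteriorAlgebra ℂ (ℂ ⊗[ℚ] V₂))
        (hω₂'.pushforward (toComplexAlg V₁ ω₁) g₁ T' (toComplexAlg V₁ x)) =
      trace (toComplexAlg V₂ ω₂) g₂ ∘ₗ LinearMap.mul ℂ (ExteriorAlgebra ℂ (ℂ ⊗[ℚ] V₂)) (toComplexAlg V₂ (hω₂.pushforward ω₁ g₁ T x)) := by
    refine linearMap_ext_of_toComplexAlg fun y ↦ ?_
    rw [LinearMap.comp_apply, LinearMap.comp_apply, LinearMap.mul_apply', LinearMap.mul_apply', hω₂'.trace_pushforward_mul, hT,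
      ← map_mul, hω₁.trace_toComplexAlg_apply hω₁', ← map_mul, hω₂.trace_toComplexAlg_apply hω₂', hω₂.trace_pushforward_mul]
  simpa only [LinearMap.comp_apply, LinearMap.mul_apply'] using LinearMap.congr_fun key Y

end BaseChange

end ExteriorLefschetz

/-! ## §4 On the carrier: Prop. 5.4, Cor. 5.5, Cor. 5.6 as printed -/

namespace HodgeStructure

open ExteriorLefschetz ExteriorAlgebra

variable {V₁ V₂ : Type u} [AddCommGroup V₁] [Module ℚ V₁] [Module.Finite ℚ V₁] [AddCommGroup V₂] [Module ℚ V₂] [Module.Finite ℚ V₂]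
  {n : ℤ} {H₁ : HodgeStructure V₁ n} {H₂ : HodgeStructure V₂ n} (Q₁ : Polarization H₁) (Q₂ : Polarization H₂) (hn : Odd n)
  {g₁ g₂ : ℕ} (hg₁ : Module.finrank ℚ V₁ = 2 * g₁) (hg₂ : Module.finrank ℚ V₂ = 2 * g₂)

include hn hg₁ in
/-- **`(φ_*)_ℂ (Θ x) = Θ (φ_* x)`** on the carrier: `φ^* = ⋀f` for `f : Hom H₂ H₁` (`f = φ^*|H¹`), `φ_*` its Gysin map for `τ_{E₁}`, `τ_{E₂}`,
`(φ_*)_ℂ` the Gysin map of `⋀f_ℂ` for `τ_{ΘE₁}`, `τ_{ΘE₂}`. [cite: Milne1999LefschetzClasses, §5 Prop. 5.4 (p. 663)] [cite: BourbakiAlgebraI1989, Ch. III §7 no. 5 Prop. 8] -/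
theorem Polarization.pushforward_toComplexAlg_apply (f : Hom H₂ H₁) (x : ExteriorAlgebra ℚ V₁) :
    (Q₂.isSymplectic_toComplexAlg_lefschetzClass hn hg₂).pushforward (toComplexAlg V₁ (Q₁.lefschetzClass : ExteriorAlgebra ℚ V₁)) g₁
        (ExteriorAlgebra.map (f.toLinearMap.baseChange ℂ)).toLinearMap (toComplexAlg V₁ x) =
      toComplexAlg V₂ ((Q₂.isSymplectic_lefschetzClass hn hg₂).pushforward (Q₁.lefschetzClass : ExteriorAlgebra ℚ V₁) g₁
        (ExteriorAlgebra.map f.toLinearMap).toLinearMap x) :=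
  (Q₁.isSymplectic_lefschetzClass hn hg₁).pushforward_toComplexAlg_apply (Q₁.isSymplectic_toComplexAlg_lefschetzClass hn hg₁)
    (Q₂.isSymplectic_lefschetzClass hn hg₂) (Q₂.isSymplectic_toComplexAlg_lefschetzClass hn hg₂)
    (fun y ↦ (toComplexAlg_map f.toLinearMap y).symm) x

include hn hg₁ in
/-- **MILNE 1999, PROP. 5.4, AS PRINTED: `φ_*` commutes with the actions of `L(A × B)`** — for every `γ₁ ⊕ γ₂ ∈ S(H₁ ⊕ H₂)(ℂ)`,
`⋀γ₂ ∘ (φ_*)_ℂ = (φ_*)_ℂ ∘ ⋀γ₁`. Here `φ^*|H¹ = f : Hom H₂ H₁`, so "`φ^*` […] is `L`-equivariant" is the intertwining clause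
`f_ℂ γ₂ = γ₁ f_ℂ` of the tree's `blockDiag_mem_lefschetzGroupBaseChange_prod_iff` (Prop. 1.5), `⋀γᵢ` fix `ΘEᵢ`
(`map_toComplexAlg_lefschetzClass_eq_of_mem_lefschetzGroupBaseChange`, "the action of `L(A)` on `H^{2g}(A)(g)` is trivial"), and §3.
[cite: Milne1999LefschetzClasses, §5 Prop. 5.4 (p. 663)] [cite: Milne1999LefschetzClasses, §1 Prop. 1.5 (p. 644)] -/
theorem Polarization.map_comp_pushforward_of_blockDiag_mem (f : Hom H₂ H₁) {γ₁ : (ℂ ⊗[ℚ] V₁) ≃ₗ[ℂ] (ℂ ⊗[ℚ] V₁)}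
    {γ₂ : (ℂ ⊗[ℚ] V₂) ≃ₗ[ℂ] (ℂ ⊗[ℚ] V₂)} (hγ : blockDiag ℂ V₁ V₂ (γ₁, γ₂) ∈ (Q₁.prod Q₂).lefschetzGroupBaseChange ℂ) :
    (ExteriorAlgebra.map (γ₂ : ℂ ⊗[ℚ] V₂ →ₗ[ℂ] ℂ ⊗[ℚ] V₂)).toLinearMap ∘ₗ
        (Q₂.isSymplectic_toComplexAlg_lefschetzClass hn hg₂).pushforward (toComplexAlg V₁ (Q₁.lefschetzClass : ExteriorAlgebra ℚ V₁)) g₁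
          (ExteriorAlgebra.map (f.toLinearMap.baseChange ℂ)).toLinearMap =
      (Q₂.isSymplectic_toComplexAlg_lefschetzClass hn hg₂).pushforward (toComplexAlg V₁ (Q₁.lefschetzClass : ExteriorAlgebra ℚ V₁)) g₁
          (ExteriorAlgebra.map (f.toLinearMap.baseChange ℂ)).toLinearMap ∘ₗ
        (ExteriorAlgebra.map (γ₁ : ℂ ⊗[ℚ] V₁ →ₗ[ℂ] ℂ ⊗[ℚ] V₁)).toLinearMap := by
  obtain ⟨hγ₁, hγ₂, -, hf⟩ := (Q₁.blockDiag_mem_lefschetzGroupBaseChange_prod_iff Q₂ γ₁ γ₂).1 hγ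
  refine (Q₁.isSymplectic_toComplexAlg_lefschetzClass hn hg₁).map_comp_pushforward (Q₂.isSymplectic_toComplexAlg_lefschetzClass hn hg₂)
    (Q₁.map_toComplexAlg_lefschetzClass_eq_of_mem_lefschetzGroupBaseChange hn hγ₁)
    (Q₂.map_toComplexAlg_lefschetzClass_eq_of_mem_lefschetzGroupBaseChange hn hγ₂) ?_
  rw [← AlgHom.comp_toLinearMap, ← AlgHom.comp_toLinearMap, map_comp_map, map_comp_map,
    show f.toLinearMap.baseChange ℂ ∘ₗ (γ₂ : ℂ ⊗[ℚ] V₂ →ₗ[ℂ] ℂ ⊗[ℚ] V₂) =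
      (γ₁ : ℂ ⊗[ℚ] V₁ →ₗ[ℂ] ℂ ⊗[ℚ] V₁) ∘ₗ f.toLinearMap.baseChange ℂ from LinearMap.ext fun y ↦ hf f y]

include hn hg₁ hg₂ in
/-- **MILNE 1999, COR. 5.6, AS PRINTED: "The graph of any regular map `α : A → B` of abelian varieties is Lefschetz."** The graph
`Γ_φ ∈ H^{2 dim B}(A × B)` is the correspondence realising `φ_*` (`Γ̄_φ = q_*(p^*(·) ∪ Γ_φ) = φ_*`), i.e. `Γ_φ = [φ_*] = corrEquiv⁻¹ φ_*`;
it is Lefschetz by Prop. 5.7 (row g32-#3 `corrEquiv_symm_mem_adjoin_hodgeClasses_two_prod_iff`) and Prop. 5.4 (Milne proves it as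
`Γ_α = (id_A, α)_*(1_A)` with Cor. 5.5; the route through 5.7 + 5.4 is the one the text takes for `Λ` in Thm. 5.9).
[cite: Milne1999LefschetzClasses, §5 Cor. 5.6 (p. 663) and Prop. 5.7 (p. 664)] -/
theorem Polarization.corrEquiv_symm_pushforward_mem_adjoin_hodgeClasses_two (f : Hom H₂ H₁) :
    (Q₁.isSymplectic_lefschetzClass hn hg₁).corrEquiv.symm
        ((Q₂.isSymplectic_lefschetzClass hn hg₂).pushforward (Q₁.lefschetzClass : ExteriorAlgebra ℚ V₁) g₁
          (ExteriorAlgebra.map f.toLinearMap).toLinearMap) ∈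
      Algebra.adjoin ℚ ((((H₁.prod H₂).exteriorPower 2).hodgeClasses n).map (⋀[ℚ]^2 (V₁ × V₂)).subtype :
        Set (ExteriorAlgebra ℚ (V₁ × V₂))) :=
  (Q₁.corrEquiv_symm_mem_adjoin_hodgeClasses_two_prod_iff Q₂ hn hg₁ (Q₁.pushforward_toComplexAlg_apply Q₂ hn hg₁ hg₂ f)).2
    fun _ _ hγ ↦ Q₁.map_comp_pushforward_of_blockDiag_mem Q₂ hn hg₁ hg₂ f hγ

include hn hg₁ hg₂ in
/-- **`Γ_φ = [φ_*] ∈ D^{g₂}(H₁ ⊕ H₂)`** — the graph is a Lefschetz class of degree `2 dim B` on `A × B` (§2 and Prop. 5.1, the tree's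
`Polarization.mem_divisorClasses_of_mem_adjoin_hodgeClasses_two`). [cite: Milne1999LefschetzClasses, §5 Cor. 5.6 (p. 663) and Prop. 5.1 (p. 662)] -/
theorem Polarization.corrEquiv_symm_pushforward_mem_map_divisorClasses (f : Hom H₂ H₁) :
    (Q₁.isSymplectic_lefschetzClass hn hg₁).corrEquiv.symm
        ((Q₂.isSymplectic_lefschetzClass hn hg₂).pushforward (Q₁.lefschetzClass : ExteriorAlgebra ℚ V₁) g₁
          (ExteriorAlgebra.map f.toLinearMap).toLinearMap) ∈
      ((H₁.prod H₂).divisorClasses g₂).map (⋀[ℚ]^(2 * g₂) (V₁ × V₂)).subtype :=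
  Submodule.mem_map.2
    ⟨⟨_, (Q₁.isSymplectic_lefschetzClass hn hg₁).corrEquiv_symm_pushforward_mem_exteriorPower (Q₂.isSymplectic_lefschetzClass hn hg₂)
        fun _ _ hy ↦ map_mem_exteriorPower f.toLinearMap hy⟩,
      (Q₁.prod Q₂).mem_divisorClasses_of_mem_adjoin_hodgeClasses_two hn
        (Q₁.corrEquiv_symm_pushforward_mem_adjoin_hodgeClasses_two Q₂ hn hg₁ hg₂ f), rfl⟩

include Q₁ hn hg₂ in
/-- **The transpose graph `ᵗΓ_φ = [φ^*]` (the correspondence from `B` to `A` realising `φ^* = ⋀f`) is Lefschetz** — "`φ^*` […] is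
`L`-equivariant" (p. 663) and Prop. 5.7. [cite: Milne1999LefschetzClasses, §5 p. 663 and Prop. 5.7 (p. 664)] -/
theorem Polarization.corrEquiv_symm_map_mem_adjoin_hodgeClasses_two (f : Hom H₂ H₁) :
    (Q₂.isSymplectic_lefschetzClass hn hg₂).corrEquiv.symm (ExteriorAlgebra.map f.toLinearMap).toLinearMap ∈
      Algebra.adjoin ℚ ((((H₂.prod H₁).exteriorPower 2).hodgeClasses n).map (⋀[ℚ]^2 (V₂ × V₁)).subtype :
        Set (ExteriorAlgebra ℚ (V₂ × V₁))) := by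
  refine (Q₂.corrEquiv_symm_mem_adjoin_hodgeClasses_two_prod_iff Q₁ hn hg₂ (T := (ExteriorAlgebra.map f.toLinearMap).toLinearMap)
    (T' := (ExteriorAlgebra.map (f.toLinearMap.baseChange ℂ)).toLinearMap) fun y ↦ (toComplexAlg_map f.toLinearMap y).symm).2
    fun γ₂ γ₁ hγ ↦ ?_
  obtain ⟨-, -, hf, -⟩ := (Q₂.blockDiag_mem_lefschetzGroupBaseChange_prod_iff Q₁ γ₂ γ₁).1 hγ
  rw [← AlgHom.comp_toLinearMap, ← AlgHom.comp_toLinearMap, map_comp_map, map_comp_map,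
    show (γ₁ : ℂ ⊗[ℚ] V₁ →ₗ[ℂ] ℂ ⊗[ℚ] V₁) ∘ₗ f.toLinearMap.baseChange ℂ =
      f.toLinearMap.baseChange ℂ ∘ₗ (γ₂ : ℂ ⊗[ℚ] V₂ →ₗ[ℂ] ℂ ⊗[ℚ] V₂) from LinearMap.ext fun y ↦ (hf f y).symm]

include Q₁ hn hg₂ in
/-- **`ᵗΓ_φ = [φ^*] ∈ D^{g₂}(H₂ ⊕ H₁)`** (`φ^* = ⋀f` preserves degrees, §2). [cite: Milne1999LefschetzClasses, §5 p. 663 and Prop. 5.1 (p. 662)] -/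
theorem Polarization.corrEquiv_symm_map_mem_map_divisorClasses (f : Hom H₂ H₁) :
    (Q₂.isSymplectic_lefschetzClass hn hg₂).corrEquiv.symm (ExteriorAlgebra.map f.toLinearMap).toLinearMap ∈
      ((H₂.prod H₁).divisorClasses g₂).map (⋀[ℚ]^(2 * g₂) (V₂ × V₁)).subtype :=
  Submodule.mem_map.2
    ⟨⟨_, (Q₂.isSymplectic_lefschetzClass hn hg₂).corrEquiv_symm_mem_exteriorPower_of_forall_apply_mem
        fun _ _ hy ↦ map_mem_exteriorPower f.toLinearMap hy⟩,
      (Q₂.prod Q₁).mem_divisorClasses_of_mem_adjoin_hodgeClasses_two hn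
        (Polarization.corrEquiv_symm_map_mem_adjoin_hodgeClasses_two Q₁ Q₂ hn hg₂ f), rfl⟩

include hn hg₁ in
/-- **MILNE 1999, COR. 5.5, AS PRINTED: "`φ_*` maps Lefschetz classes on `A` to Lefschetz classes on `B`"** — for `x ∈ ℚ[B¹(H₁)]`,
`φ_* x ∈ ℚ[B¹(H₂)]`: "`φ_*` commutes with the actions of `L(A × B)`, it maps classes fixed by `L(A)` to classes fixed by `L(B)`, and we
can apply Corollary 4.5" (the tree's `mem_adjoin_hodgeClasses_two_iff_forall_map_toComplexAlg_eq`). As in row g32-#3 (Prop. 5.7, second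
statement) the hypothesis `hsurj` is "`L(B)` is a quotient of `L(A × B)`" on `ℂ`-points: every `γ₂ ∈ S(H₂)(ℂ)` lifts to some
`γ₁ ⊕ γ₂ ∈ S(H₁ ⊕ H₂)(ℂ)`; it holds for `A = B` (next statement). [cite: Milne1999LefschetzClasses, §5 Cor. 5.5 (p. 663) and §4 Cor. 4.5 (p. 659)] -/
theorem Polarization.pushforward_apply_mem_adjoin_hodgeClasses_two
    (hsurj : ∀ γ₂ ∈ Q₂.lefschetzGroupBaseChange ℂ, ∃ γ₁ : (ℂ ⊗[ℚ] V₁) ≃ₗ[ℂ] (ℂ ⊗[ℚ] V₁),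
      blockDiag ℂ V₁ V₂ (γ₁, γ₂) ∈ (Q₁.prod Q₂).lefschetzGroupBaseChange ℂ)
    (f : Hom H₂ H₁) {x : ExteriorAlgebra ℚ V₁}
    (hx : x ∈ Algebra.adjoin ℚ (((H₁.exteriorPower 2).hodgeClasses n).map (⋀[ℚ]^2 V₁).subtype : Set (ExteriorAlgebra ℚ V₁))) :
    (Q₂.isSymplectic_lefschetzClass hn hg₂).pushforward (Q₁.lefschetzClass : ExteriorAlgebra ℚ V₁) g₁
        (ExteriorAlgebra.map f.toLinearMap).toLinearMap x ∈
      Algebra.adjoin ℚ (((H₂.exteriorPower 2).hodgeClasses n).map (⋀[ℚ]^2 V₂).subtype : Set (ExteriorAlgebra ℚ V₂)) := by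
  rw [Q₂.mem_adjoin_hodgeClasses_two_iff_forall_map_toComplexAlg_eq hn]
  intro γ₂ hγ₂
  obtain ⟨γ₁, hγ⟩ := hsurj γ₂ hγ₂
  have hγ₁ : γ₁ ∈ Q₁.lefschetzGroupBaseChange ℂ := ((Q₁.blockDiag_mem_lefschetzGroupBaseChange_prod_iff Q₂ γ₁ γ₂).1 hγ).1
  have hx' := (Q₁.mem_adjoin_hodgeClasses_two_iff_forall_map_toComplexAlg_eq hn x).1 hx γ₁ hγ₁
  have key := LinearMap.congr_fun (Q₁.map_comp_pushforward_of_blockDiag_mem Q₂ hn hg₁ hg₂ f hγ) (toComplexAlg V₁ x)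
  simp only [LinearMap.comp_apply, AlgHom.toLinearMap_apply] at key
  rw [hx', Q₁.pushforward_toComplexAlg_apply Q₂ hn hg₁ hg₂] at key
  exact key

include hn hg₁ in
/-- **COR. 5.5 for an endomorphism `φ : A → A` (unconditionally): `φ_*` maps `ℚ[B¹(H)]` into itself** (every `γ ∈ S(H)(ℂ)` lifts as
`γ ⊕ γ ∈ S(H ⊕ H)(ℂ)`, the tree's `blockDiag_mem_lefschetzGroupBaseChange_prod_self_iff`). [cite: Milne1999LefschetzClasses, §5 Cor. 5.5 (p. 663) and §3 p. 654] -/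
theorem Polarization.pushforward_apply_mem_adjoin_hodgeClasses_two_of_prod_self (f : Hom H₁ H₁) {x : ExteriorAlgebra ℚ V₁}
    (hx : x ∈ Algebra.adjoin ℚ (((H₁.exteriorPower 2).hodgeClasses n).map (⋀[ℚ]^2 V₁).subtype : Set (ExteriorAlgebra ℚ V₁))) :
    (Q₁.isSymplectic_lefschetzClass hn hg₁).pushforward (Q₁.lefschetzClass : ExteriorAlgebra ℚ V₁) g₁
        (ExteriorAlgebra.map f.toLinearMap).toLinearMap x ∈
      Algebra.adjoin ℚ (((H₁.exteriorPower 2).hodgeClasses n).map (⋀[ℚ]^2 V₁).subtype : Set (ExteriorAlgebra ℚ V₁)) :=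
  Q₁.pushforward_apply_mem_adjoin_hodgeClasses_two Q₁ hn hg₁ hg₁
    (fun γ hγ ↦ ⟨γ, (Q₁.blockDiag_mem_lefschetzGroupBaseChange_prod_self_iff γ γ).2 ⟨hγ, rfl⟩⟩) f hx

end HodgeStructure

end Literature.AlgebraicGeometry.Motives
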